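import Literature.NumberTheory.DiophantineGeometry.GenEllDifferentUpperBound
import Mathlib.NumberTheory.RamificationInertia.Valuation
import HarnessLib

/-!
# Radical (Kummer) layers are unramified away from the exponent and the radicand;
# [GenEll] Prop. 1.7 (i), right inequality, for the Kummer covering of `ℙ¹ ∖ {0, 1, ∞}`

S. Mochizuki, *Arithmetic elliptic curves in general position*, Math. J. Okayama Univ. 52 (2010)
[cite: MochizukiGenEll2010], proof of Prop. 1.7 (i) p. 10 ("there exists a finite set of prime
numbers `Σ` such that the restriction of `Y → Z` to the spectrum of `ℤ[Σ⁻¹]` is a finite tamely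
ramified morphism of smooth, proper families of curves"): for the coverings the proof of Thm. 2.1
uses over `ℙ¹` — Galois coverings ramified over `{0, 1, ∞}` with all indices `e`, i.e. Kummer
coverings `x ↦ (x^{1/e}, (1−x)^{1/e})` and their Galois closures — the relevant arithmetic fact is
the classical one proved here: a radical layer `L = K(β)`, `β^k = a ∈ K`, is unramified at every
prime of `K` not dividing `k` at which `a` is a unit. We prove it in the form the tree's different
engine consumes (`GenEllConductorDifferent`, `GenEllDifferentUpperBound`): such primes do not divide
the relative different.

* `not_dvd_differentIdeal_of_aeval_derivative_notMem` — **derivative criterion**: if `L = K(α)`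
  with `α ∈ 𝓞_L` and `g'(α) ∉ w` for the minimal polynomial `g` of `α` over `𝓞_K`, then
  `w ∤ 𝔇_{L/K}` (Mathlib `aeval_derivative_mem_differentIdeal`: `g'(α) ∈ 𝔇_{L/K}`);
* `not_dvd_differentIdeal_of_radical` — **radical layers**: `L = K(β)`, `β^k = a`, `k ≠ 0`, `v` a
  prime of `K` with `k ∉ v` and `|a|_v = 1`; then no prime `w` of `L` above `v` divides `𝔇_{L/K}`
  (generator `α = d·β` with `a = n/d`, `n, d ∉ v` — Mathlib `exists_primeCompl_mul_eq_of_integer` —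
  whose minimal polynomial divides `T^k − d^{k−1} n`, so `g'(α) ∣ k·α^{k−1}`, a `w`-unit);
* `not_dvd_differentIdeal_of_tower` — **towers**: `w ∤ 𝔇_{L/M}` and `(w ∩ 𝓞_M) ∤ 𝔇_{M/K}` imply
  `w ∤ 𝔇_{L/K}` (transitivity of the different);
* `not_dvd_differentIdeal_kummer` — for a point `x ∈ U(K)` of `ℙ¹ ∖ {0,1,∞}` (tree `NFPoint`) and a
  tower `K ⊆ K₁ = K(ζ) ⊆ K₂ = K₁(u) ⊆ N = K₂(w)`, `ζ^e = 1`, `u^e = x`, `w^e = 1 − x`: a prime of `N`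
  lying over a prime `v` of `K` OUTSIDE the support of the conductor of `x` at `C = [0]+[1]+[∞]`
  (tree `NFPoint.condSupport`) and not dividing `e` does not divide `𝔇_{N/K}`;
* `logdisc_kummer_le` — **[GenEll] Prop. 1.7 (i), right inequality, for the Kummer covering of
  `(ℙ¹, C)`** (the covering `Y → ℙ¹` of the proof of Thm. 2.1, p. 11, in Galois-closed form): if
  moreover `N/K` is Galois of degree `n`, then
  `logdisc N ≤ log-diff(x) + log-cond_C(x) + log e + log n + log n!`
  (engine: `logdisc_sub_logdisc_le_cond` of `GenEllDifferentUpperBound`); since `logdisc` is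
  monotone in towers (`logdisc_le_logdisc`), the same bound holds for the field of definition of
  any point `(u, w)` of the Fermat curve `u^e + w^e = 1` above `x = u^e`.

Classical (Neukirch, *Algebraic Number Theory*, I (8.3)/III (2.6)-style statements); filed under
[GenEll] because it is exactly the "`Σ`" bookkeeping of Prop. 1.7's proof for the Kummer
coverings of Thm. 2.1. Not here: the CONSTRUCTION of the tower `K₁, K₂, N` from `x` (splitting
field of `(T^e − x)(T^e − (1 − x))`, Galois of degree `≤ e³`) — taken as hypotheses. Theorems
only; no definitions, no named facts.
-/

noncomputable section

open NumberField IsDedekindDomain Ideal Polynomial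

namespace Literature.NumberTheory.DiophantineGeometry.GenEll

section Derivative

variable (K L : Type*) [Field K] [NumberField K] [Field L] [NumberField L] [Algebra K L]

/-- **Derivative criterion for the different.** If `L = K(α)` with `α ∈ 𝓞_L`, `g` the minimal
polynomial of `α` over `𝓞_K`, and `w` a prime of `L` with `g'(α) ∉ w`, then `w ∤ 𝔇_{L/K}` (since
`g'(α) ∈ 𝔇_{L/K}`, Mathlib `aeval_derivative_mem_differentIdeal`).
[cite: MochizukiGenEll2010, Prop 1.7 (i) p.10] -/
theorem not_dvd_differentIdeal_of_aeval_derivative_notMem (α : 𝓞 L)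
    (hα : Algebra.adjoin K {(α : L)} = ⊤) (w : HeightOneSpectrum (𝓞 L))
    (h : aeval α (derivative (minpoly (𝓞 K) α)) ∉ w.asIdeal) :
    ¬ w.asIdeal ∣ differentIdeal (𝓞 K) (𝓞 L) := by
  intro hdvd
  have hmem : aeval α (derivative (minpoly (𝓞 K) α)) ∈ differentIdeal (𝓞 K) (𝓞 L) :=
    aeval_derivative_mem_differentIdeal (𝓞 K) K L α hα
  exact h ((Ideal.le_of_dvd hdvd) hmem)

end Derivative

section Radical

variable {K L : Type*} [Field K] [NumberField K] [Field L] [NumberField L] [Algebra K L]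

/-- If `a ∈ K` is a `v`-adic unit then `a = n/d` with `n, d ∈ 𝓞_K ∖ v`. [folklore] -/
private theorem exists_eq_div_of_valuation_eq_one (v : HeightOneSpectrum (𝓞 K)) {a : K}
    (ha : v.valuation K a = 1) :
    ∃ n d : 𝓞 K, n ∉ v.asIdeal ∧ d ∉ v.asIdeal ∧ a * algebraMap (𝓞 K) K d = algebraMap (𝓞 K) K n := by
  obtain ⟨n, d, hnd⟩ := v.exists_primeCompl_mul_eq_of_integer a ha.le
  refine ⟨n, d, ?_, d.2, hnd⟩
  have hd : v.valuation K (algebraMap (𝓞 K) K (d : 𝓞 K)) = 1 := by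
    rw [HeightOneSpectrum.valuation_of_algebraMap]
    exact (v.intValuation_eq_one_iff_mem_primeCompl (d : 𝓞 K)).mpr d.2
  have hn : v.valuation K (algebraMap (𝓞 K) K n) = 1 := by rw [← hnd, map_mul, ha, hd, one_mul]
  rw [HeightOneSpectrum.valuation_of_algebraMap] at hn
  exact (v.intValuation_eq_one_iff_mem_primeCompl n).mp hn

/-- **Radical layers are unramified away from `k` and the radicand.** Let `L = K(β)` with
`β^k = a ∈ K`, `k ≠ 0`, and let `v` be a prime of `K` with `k ∉ v` and `|a|_v = 1`. Then no prime
`w` of `L` above `v` divides the relative different `𝔇_{L/K}` (i.e. `L/K` is unramified above `v`).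
[cite: MochizukiGenEll2010, Prop 1.7 (i) p.10] -/
theorem not_dvd_differentIdeal_of_radical {β : L} {k : ℕ} (hk : k ≠ 0) {a : K}
    (hβ : β ^ k = algebraMap K L a) (hgen : Algebra.adjoin K {β} = ⊤)
    (v : HeightOneSpectrum (𝓞 K)) (hvk : ((k : ℕ) : 𝓞 K) ∉ v.asIdeal)
    (hva : v.valuation K a = 1) (w : HeightOneSpectrum (𝓞 L)) (hw : w.under (𝓞 K) = v) :
    ¬ w.asIdeal ∣ differentIdeal (𝓞 K) (𝓞 L) := by
  obtain ⟨n, d, hn, hd, hnd⟩ := exists_eq_div_of_valuation_eq_one v hva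
  have hkpos : 0 < k := Nat.pos_of_ne_zero hk
  -- the integral generator `α = d · β`, with `α^k = c := d^(k-1) · n ∈ 𝓞_K`
  set c : 𝓞 K := d ^ (k - 1) * n with hc_def
  set α₀ : L := algebraMap K L (algebraMap (𝓞 K) K d) * β with hα₀_def
  have hα₀k : α₀ ^ k = algebraMap K L (algebraMap (𝓞 K) K c) := by
    simp only [hα₀_def, hc_def, mul_pow, hβ, map_mul, map_pow]
    rw [← hnd, map_mul, ← pow_sub_one_mul hk (algebraMap K L (algebraMap (𝓞 K) K d))]
    ring
  have hα₀int : IsIntegral ℤ α₀ := by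
    refine IsIntegral.of_pow hkpos ?_
    rw [hα₀k, ← IsScalarTower.algebraMap_apply]
    exact (RingOfIntegers.isIntegral c).map (IsScalarTower.toAlgHom ℤ (𝓞 K) L)
  set α : 𝓞 L := ⟨α₀, (mem_integralClosure_iff ℤ L).mpr hα₀int⟩ with hα_def
  have hαL : (α : L) = α₀ := rfl
  have hαk : α ^ k = algebraMap (𝓞 K) (𝓞 L) c := by
    apply RingOfIntegers.coe_injective
    rw [map_pow]
    change (α : L) ^ k = ((algebraMap (𝓞 K) (𝓞 L) c : 𝓞 L) : L)
    rw [hαL, hα₀k, ← IsScalarTower.algebraMap_apply]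
    exact IsScalarTower.algebraMap_apply (𝓞 K) (𝓞 L) L c
  -- `L = K(α)`
  have hd0 : (algebraMap (𝓞 K) K d) ≠ 0 := fun h0 => hd (by
    rw [RingOfIntegers.coe_eq_zero_iff.mp h0]; exact v.asIdeal.zero_mem)
  have hgenα : Algebra.adjoin K {(α : L)} = ⊤ := by
    rw [hαL, eq_top_iff, ← hgen, Algebra.adjoin_le_iff, Set.singleton_subset_iff]
    have : β = (algebraMap (𝓞 K) K d)⁻¹ • α₀ := by
      rw [hα₀_def, Algebra.smul_def, map_inv₀, ← mul_assoc, inv_mul_cancel₀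
        ((_root_.map_ne_zero _).mpr hd0), one_mul]
    rw [this]
    exact Subalgebra.smul_mem _ (Algebra.self_mem_adjoin_singleton K α₀) _
  -- the minimal polynomial divides `T^k − c`, so `g'(α) · q(α) = k α^(k−1)`
  set P : (𝓞 K)[X] := X ^ k - C c with hP_def
  have hPα : aeval α P = 0 := by rw [hP_def, map_sub, aeval_X_pow, aeval_C, hαk, sub_self]
  have hαint : IsIntegral (𝓞 K) α := ⟨P, by
    rw [hP_def]; exact monic_X_pow_sub_C c hk, by rw [← aeval_def]; exact hPα⟩
  obtain ⟨q, hq⟩ := minpoly.isIntegrallyClosed_dvd hαint hPα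
  have hderiv : (k : 𝓞 L) * α ^ (k - 1) =
      aeval α (derivative (minpoly (𝓞 K) α)) * aeval α q := by
    have h1 : derivative P = derivative (minpoly (𝓞 K) α) * q + minpoly (𝓞 K) α * derivative q := by
      rw [hq, derivative_mul]
    have h2 : aeval α (derivative P) = (k : 𝓞 L) * α ^ (k - 1) := by
      rw [hP_def, derivative_sub, derivative_X_pow, derivative_C, sub_zero, map_mul, aeval_X_pow,
        aeval_C, map_natCast]
    rw [← h2, h1, map_add, map_mul, map_mul, minpoly.aeval, zero_mul, add_zero]
  -- `g'(α) ∉ w`: otherwise `k ∈ w` or `α ∈ w`, and both contradict the hypotheses at `v = w ∩ 𝓞_K`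
  refine not_dvd_differentIdeal_of_aeval_derivative_notMem K L α hgenα w fun hmem => ?_
  have hkα : (k : 𝓞 L) * α ^ (k - 1) ∈ w.asIdeal := by
    rw [hderiv]; exact w.asIdeal.mul_mem_right _ hmem
  have hcomap : ∀ z : 𝓞 K, algebraMap (𝓞 K) (𝓞 L) z ∈ w.asIdeal → z ∈ v.asIdeal := by
    intro z hz
    rw [← hw]
    exact hz
  rcases w.isPrime.mem_or_mem hkα with h1 | h1
  · exact hvk (hcomap _ (by rwa [map_natCast]))
  · have hαw : α ∈ w.asIdeal := w.isPrime.mem_of_pow_mem _ h1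
    have hck : algebraMap (𝓞 K) (𝓞 L) c ∈ w.asIdeal := by
      rw [← hαk]; exact w.asIdeal.pow_mem_of_mem hαw k hkpos
    rcases v.isPrime.mem_or_mem (hc_def ▸ hcomap c hck) with h2 | h2
    · exact hd (v.isPrime.mem_of_pow_mem _ h2)
    · exact hn h2

end Radical

section Tower

variable (K M L : Type*) [Field K] [NumberField K] [Field M] [NumberField M] [Field L]
  [NumberField L] [Algebra K M] [Algebra M L] [Algebra K L] [IsScalarTower K M L]

/-- **Towers.** For number fields `K ⊆ M ⊆ L` and a prime `w` of `L`: if `w ∤ 𝔇_{L/M}` and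
`(w ∩ 𝓞_M) ∤ 𝔇_{M/K}` then `w ∤ 𝔇_{L/K}` (transitivity of the different
`𝔇_{L/K} = 𝔇_{L/M} · 𝔇_{M/K} 𝓞_L`). [cite: MochizukiGenEll2010, Prop 1.7 (i) p.10] -/
theorem not_dvd_differentIdeal_of_tower (w : HeightOneSpectrum (𝓞 L))
    (hL : ¬ w.asIdeal ∣ differentIdeal (𝓞 M) (𝓞 L))
    (hM : ¬ (w.under (𝓞 M)).asIdeal ∣ differentIdeal (𝓞 K) (𝓞 M)) :
    ¬ w.asIdeal ∣ differentIdeal (𝓞 K) (𝓞 L) := by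
  rw [differentIdeal_eq_differentIdeal_mul_differentIdeal (𝓞 K) (𝓞 M) (𝓞 L)]
  intro h
  rcases (Ideal.prime_of_isPrime w.ne_bot w.isPrime).dvd_or_dvd h with h1 | h1
  · exact hL h1
  · apply hM
    rw [Ideal.dvd_iff_le] at h1 ⊢
    rw [Ideal.map_le_iff_le_comap] at h1
    exact h1

end Tower

/-! ## The Kummer covering `x ↦ (ζ_e, x^{1/e}, (1 − x)^{1/e})` of `ℙ¹ ∖ {0, 1, ∞}` -/

section Kummer

variable (P : NFPoint) (K₁ K₂ N : Type) [Field K₁] [NumberField K₁] [Field K₂] [NumberField K₂]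
  [Field N] [NumberField N] [Algebra P.F K₁] [Algebra K₁ K₂] [Algebra K₂ N] [Algebra P.F K₂]
  [Algebra P.F N] [IsScalarTower P.F K₁ K₂] [IsScalarTower P.F K₂ N]

/-- Off the support of the conductor at `C`, `x` and `1 − x` are `v`-adic units.
[cite: MochizukiGenEll2010, Def 1.5 (iv) p.8] -/
theorem NFPoint.valuation_eq_one_of_notMem_condSupport {v : HeightOneSpectrum (𝓞 P.F)}
    (hv : v ∉ P.condSupport) :
    v.valuation P.F P.x = 1 ∧ v.valuation P.F (1 - P.x) = 1 := by
  simp only [NFPoint.condSupport, Set.mem_setOf_eq, not_or, not_lt] at hv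
  obtain ⟨h1, h2, h3⟩ := hv
  have hx : v.valuation P.F P.x = 1 := le_antisymm h2 h1
  refine ⟨hx, le_antisymm ?_ ?_⟩
  · calc v.valuation P.F (1 - P.x) ≤ max (v.valuation P.F 1) (v.valuation P.F P.x) :=
        Valuation.map_sub _ _ _
      _ = 1 := by rw [map_one, hx, max_self]
  · rw [← Valuation.map_neg, neg_sub]; exact h3

/-- **The Kummer tower is unramified off `supp cond_C(x) ∪ {v ∣ e}`.** For the tower
`K = ℚ(x)… ⊆ K₁ = K(ζ) ⊆ K₂ = K₁(u) ⊆ N = K₂(w)` with `ζ^e = 1`, `u^e = x`, `w^e = 1 − x`: a prime `𝔓`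
of `N` whose restriction `v` to `K` is outside the support of the conductor of `x` at
`C = [0]+[1]+[∞]` and does not contain `e` does not divide `𝔇_{N/K}`.
[cite: MochizukiGenEll2010, Prop 1.7 (i) p.10] -/
theorem not_dvd_differentIdeal_kummer {e : ℕ} (he : e ≠ 0)
    {ζ : K₁} (hζ : ζ ^ e = 1) (hK₁ : Algebra.adjoin P.F {ζ} = ⊤)
    {u : K₂} (hu : u ^ e = algebraMap P.F K₂ P.x) (hK₂ : Algebra.adjoin K₁ {u} = ⊤)
    {w : N} (hw : w ^ e = algebraMap P.F N (1 - P.x)) (hN : Algebra.adjoin K₂ {w} = ⊤)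
    (𝔓 : HeightOneSpectrum (𝓞 N)) (h1 : 𝔓.under (𝓞 P.F) ∉ P.condSupport)
    (h2 : ((e : ℕ) : 𝓞 P.F) ∉ (𝔓.under (𝓞 P.F)).asIdeal) :
    ¬ 𝔓.asIdeal ∣ differentIdeal (𝓞 P.F) (𝓞 N) := by
  set v : HeightOneSpectrum (𝓞 P.F) := 𝔓.under (𝓞 P.F) with hv_def
  set v₂ : HeightOneSpectrum (𝓞 K₂) := 𝔓.under (𝓞 K₂) with hv₂_def
  set v₁ : HeightOneSpectrum (𝓞 K₁) := v₂.under (𝓞 K₁) with hv₁_def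
  have hv₂ : v₂.under (𝓞 P.F) = v := by
    ext1
    change (𝔓.asIdeal.comap (algebraMap (𝓞 K₂) (𝓞 N))).comap (algebraMap (𝓞 P.F) (𝓞 K₂)) =
      𝔓.asIdeal.comap (algebraMap (𝓞 P.F) (𝓞 N))
    rw [Ideal.comap_comap, ← IsScalarTower.algebraMap_eq]
  have hv₁ : v₁.under (𝓞 P.F) = v := by
    rw [← hv₂]
    ext1
    change (v₂.asIdeal.comap (algebraMap (𝓞 K₁) (𝓞 K₂))).comap (algebraMap (𝓞 P.F) (𝓞 K₁)) =
      v₂.asIdeal.comap (algebraMap (𝓞 P.F) (𝓞 K₂))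
    rw [Ideal.comap_comap, ← IsScalarTower.algebraMap_eq]
  obtain ⟨hx, h1x⟩ := P.valuation_eq_one_of_notMem_condSupport h1
  -- `e` stays outside the primes above `v`
  have he₂ : ((e : ℕ) : 𝓞 K₂) ∉ v₂.asIdeal := fun h => h2 (by
    rw [← hv₂]
    change ((e : ℕ) : 𝓞 P.F) ∈ v₂.asIdeal.comap (algebraMap (𝓞 P.F) (𝓞 K₂))
    rw [Ideal.mem_comap, map_natCast]; exact h)
  have he₁ : ((e : ℕ) : 𝓞 K₁) ∉ v₁.asIdeal := fun h => he₂ (by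
    change ((e : ℕ) : 𝓞 K₁) ∈ v₂.asIdeal.comap (algebraMap (𝓞 K₁) (𝓞 K₂)) at h
    rw [Ideal.mem_comap, map_natCast] at h; exact h)
  -- the radicands stay units above `v`
  haveI : v₂.asIdeal.LiesOver v.asIdeal := ⟨by rw [← hv₂]; rfl⟩
  haveI : v₁.asIdeal.LiesOver v.asIdeal := ⟨by rw [← hv₁]; rfl⟩
  have hx₁ : v₁.valuation K₁ (algebraMap P.F K₁ P.x) = 1 := by
    rw [← HeightOneSpectrum.valuation_liesOver K₁ v v₁, hx, one_pow]
  have h1x₂ : v₂.valuation K₂ (algebraMap P.F K₂ (1 - P.x)) = 1 := by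
    rw [← HeightOneSpectrum.valuation_liesOver K₂ v v₂, h1x, one_pow]
  -- the three layers
  have hζ' : ζ ^ e = algebraMap P.F K₁ 1 := by rw [hζ, map_one]
  have l₁ : ¬ v₁.asIdeal ∣ differentIdeal (𝓞 P.F) (𝓞 K₁) :=
    not_dvd_differentIdeal_of_radical he hζ' hK₁ v h2 (by rw [map_one]) v₁ hv₁
  have hu' : u ^ e = algebraMap K₁ K₂ (algebraMap P.F K₁ P.x) := by
    rw [hu, IsScalarTower.algebraMap_apply P.F K₁ K₂]
  have l₂ : ¬ v₂.asIdeal ∣ differentIdeal (𝓞 K₁) (𝓞 K₂) :=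
    not_dvd_differentIdeal_of_radical he hu' hK₂ v₁ he₁ hx₁ v₂ rfl
  have hw' : w ^ e = algebraMap K₂ N (algebraMap P.F K₂ (1 - P.x)) := by
    rw [hw, IsScalarTower.algebraMap_apply P.F K₂ N]
  have l₃ : ¬ 𝔓.asIdeal ∣ differentIdeal (𝓞 K₂) (𝓞 N) :=
    not_dvd_differentIdeal_of_radical he hw' hN v₂ he₂ h1x₂ 𝔓 rfl
  -- assemble along the two towers
  have t₁ : ¬ v₂.asIdeal ∣ differentIdeal (𝓞 P.F) (𝓞 K₂) :=
    not_dvd_differentIdeal_of_tower P.F K₁ K₂ v₂ l₂ l₁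
  exact not_dvd_differentIdeal_of_tower P.F K₂ N 𝔓 l₃ t₁

/-- The log-conductor at `C` as a finite sum over the support (cf. `GenEllPullbackConductor`).
[cite: MochizukiGenEll2010, Def 1.5 (iv) p.8] -/
private theorem NFPoint.logCond_eq_sum' (hP : P.InU) :
    P.logCond = (P.degree : ℝ)⁻¹ *
      ∑ v ∈ (P.condSupport_finite hP).toFinset, Real.log (Ideal.absNorm v.asIdeal : ℝ) := by
  rw [NFPoint.logCond, finprod_mem_eq_finite_toFinset_prod _ (P.condSupport_finite hP),
    Nat.cast_prod, Real.log_prod]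
  exact fun v _ => Nat.cast_ne_zero.mpr (by rw [Ne, Ideal.absNorm_eq_zero_iff]; exact v.ne_bot)

/-- The primes of `K` containing a positive integer `m` have total `log`-norm at most
`[K:ℚ]·log m` (their product divides `m·𝒪_K`, of norm `m^{[K:ℚ]}`). [folklore] -/
private theorem sum_log_absNorm_le_of_natCast_mem {F : Type*} [Field F] [NumberField F] {m : ℕ}
    (hm : 0 < m) (E : Finset (HeightOneSpectrum (𝓞 F)))
    (hE : ∀ v ∈ E, ((m : ℕ) : 𝓞 F) ∈ v.asIdeal) :
    ∑ v ∈ E, Real.log (Ideal.absNorm v.asIdeal : ℝ) ≤ Module.finrank ℚ F * Real.log m := by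
  classical
  set J : Ideal (𝓞 F) := ∏ v ∈ E, v.asIdeal with hJ
  have hdvd : J ∣ Ideal.span {((m : ℕ) : 𝓞 F)} := by
    refine Finset.prod_dvd_of_coprime (fun v _ v' _ hne => ?_) fun v hv => ?_
    · exact Ideal.isCoprime_iff_sup_eq.mpr (v.isMaximal.coprime_of_ne v'.isMaximal
        fun h => hne (HeightOneSpectrum.ext h))
    · rw [Ideal.dvd_span_singleton]; exact hE v hv
  have hm0 : Ideal.span {((m : ℕ) : 𝓞 F)} ≠ ⊥ := by
    rw [Ne, Ideal.span_singleton_eq_bot]; exact_mod_cast hm.ne'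
  have hN : (Ideal.absNorm J : ℝ) ≤ Ideal.absNorm (Ideal.span {((m : ℕ) : 𝓞 F)}) := by
    exact_mod_cast Nat.le_of_dvd (Nat.pos_of_ne_zero (by rwa [Ne, Ideal.absNorm_eq_zero_iff]))
      (Ideal.absNorm_dvd_absNorm_of_le (Ideal.le_of_dvd hdvd))
  have hNm : (Ideal.absNorm (Ideal.span {((m : ℕ) : 𝓞 F)}) : ℝ) = (m : ℝ) ^ Module.finrank ℚ F := by
    rw [Ideal.absNorm_span_singleton, show ((m : ℕ) : 𝓞 F) = algebraMap ℤ (𝓞 F) (m : ℤ) by simp,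
      Algebra.norm_algebraMap, NumberField.RingOfIntegers.rank, Int.natAbs_pow, Int.natAbs_natCast,
      Nat.cast_pow]
  have hpos : ∀ v ∈ E, (0 : ℝ) < Ideal.absNorm v.asIdeal := fun v _ => by
    exact_mod_cast Nat.pos_of_ne_zero (by rw [Ne, Ideal.absNorm_eq_zero_iff]; exact v.ne_bot)
  have hlogJ : Real.log (Ideal.absNorm J : ℝ) = ∑ v ∈ E, Real.log (Ideal.absNorm v.asIdeal : ℝ) := by
    rw [hJ, map_prod, Nat.cast_prod, Real.log_prod]
    exact fun v hv => (hpos v hv).ne'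
  have hJpos : (0 : ℝ) < Ideal.absNorm J := by
    rw [hJ, map_prod, Nat.cast_prod]; exact Finset.prod_pos hpos
  rw [← hlogJ, ← Real.log_pow, ← hNm]
  exact Real.log_le_log hJpos hN

/-- **[GenEll] Prop. 1.7 (i), right inequality, for the Kummer covering of `ℙ¹ ∖ {0,1,∞}`
(the covering `Y → ℙ¹` the proof of Thm. 2.1 uses, in the Galois-closed form
`K ⊆ K(ζ_e) ⊆ K(ζ_e, x^{1/e}) ⊆ N = K(ζ_e, x^{1/e}, (1−x)^{1/e})`).** For a point `x ∈ U(K)` presented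
over `K` and such a tower with `N/K` Galois of degree `n`:
`logdisc N ≤ log-diff(x) + log-cond_C(x) + log e + log n + log n!` — the log-different of every point
of the covering curve above `x` (its field of definition embeds in `N`, and `logdisc` is monotone,
`logdisc_le_logdisc`) exceeds `log-diff(x)` by at most `log-cond_C(x)` plus a constant depending
only on the covering. [cite: MochizukiGenEll2010, Prop 1.7 (i) p.9] -/
theorem logdisc_kummer_le [IsGalois P.F N] (hP : P.InU) {e : ℕ} (he : e ≠ 0)
    {ζ : K₁} (hζ : ζ ^ e = 1) (hK₁ : Algebra.adjoin P.F {ζ} = ⊤)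
    {u : K₂} (hu : u ^ e = algebraMap P.F K₂ P.x) (hK₂ : Algebra.adjoin K₁ {u} = ⊤)
    {w : N} (hw : w ^ e = algebraMap P.F N (1 - P.x)) (hN : Algebra.adjoin K₂ {w} = ⊤) :
    (Module.finrank ℚ N : ℝ)⁻¹ * Real.log ((discr N).natAbs : ℝ) ≤
      P.logDiff + P.logCond + (Real.log e + Real.log (Module.finrank P.F N) +
        Real.log (Module.finrank P.F N).factorial) := by
  classical
  set n := Module.finrank P.F N with hn_def
  have hfinS := P.condSupport_finite hP
  set S : Finset (HeightOneSpectrum (𝓞 P.F)) := hfinS.toFinset with hS_def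
  have he0 : Ideal.span {((e : ℕ) : 𝓞 P.F)} ≠ ⊥ := by
    rw [Ne, Ideal.span_singleton_eq_bot]; exact_mod_cast he
  have hfinE := Ideal.finite_factors he0
  set E : Finset (HeightOneSpectrum (𝓞 P.F)) := hfinE.toFinset with hE_def
  have hEmem : ∀ v : HeightOneSpectrum (𝓞 P.F), v ∈ E ↔ ((e : ℕ) : 𝓞 P.F) ∈ v.asIdeal := fun v => by
    rw [hE_def, Set.Finite.mem_toFinset, Set.mem_setOf_eq, Ideal.dvd_span_singleton]
  -- the engine, with `S' = S ∪ E`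
  have hS' : ∀ 𝔓 : HeightOneSpectrum (𝓞 N), 𝔓.asIdeal ∣ differentIdeal (𝓞 P.F) (𝓞 N) →
      𝔓.under (𝓞 P.F) ∈ S ∪ E ∨ ((n : ℕ) : 𝓞 N) ∈ 𝔓.asIdeal := by
    intro 𝔓 h𝔓
    left
    rw [Finset.mem_union, hS_def, Set.Finite.mem_toFinset, hEmem]
    by_contra hcon
    push Not at hcon
    exact not_dvd_differentIdeal_kummer P K₁ K₂ N he hζ hK₁ hu hK₂ hw hN 𝔓 hcon.1 hcon.2 h𝔓
  have hmain := logdisc_sub_logdisc_le_cond P.F N (S ∪ E) hS'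
  -- bound the pieces
  have hlogN : ∀ {F : Type} [Field F] [NumberField F] (v : HeightOneSpectrum (𝓞 F)),
      0 ≤ Real.log (Ideal.absNorm v.asIdeal : ℝ) := fun v =>
    Real.log_nonneg (Nat.one_le_cast.mpr
      (Nat.one_le_iff_ne_zero.mpr (by rw [Ne, Ideal.absNorm_eq_zero_iff]; exact v.ne_bot)))
  have hKpos : (0 : ℝ) < Module.finrank ℚ P.F := by exact_mod_cast Module.finrank_pos
  have hNpos : (0 : ℝ) < Module.finrank ℚ N := by exact_mod_cast Module.finrank_pos
  have hdeg : (Module.finrank ℚ P.F : ℝ) = P.degree := rfl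
  have h1 : ∑ v ∈ S ∪ E, Real.log (Ideal.absNorm v.asIdeal : ℝ) ≤
      ∑ v ∈ S, Real.log (Ideal.absNorm v.asIdeal : ℝ) + ∑ v ∈ E, Real.log (Ideal.absNorm v.asIdeal : ℝ) := by
    rw [← Finset.sum_union_inter]
    linarith [Finset.sum_nonneg fun v (_ : v ∈ S ∩ E) => hlogN v]
  have h2 : ∑ v ∈ E, Real.log (Ideal.absNorm v.asIdeal : ℝ) ≤ Module.finrank ℚ P.F * Real.log e :=
    sum_log_absNorm_le_of_natCast_mem (Nat.pos_of_ne_zero he) E fun v hv => (hEmem v).mp hv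
  have h3 : 0 ≤ ∑ v ∈ S ∪ E, ∑ w ∈ IsDedekindDomain.primesOverFinset v.asIdeal (𝓞 N),
      Real.log (Ideal.absNorm w : ℝ) := by
    refine Finset.sum_nonneg fun v _ => Finset.sum_nonneg fun w hw => Real.log_nonneg ?_
    have hw' := (IsDedekindDomain.mem_primesOverFinset_iff v.ne_bot (𝓞 N)).mp hw
    haveI : w.IsPrime := hw'.1
    exact_mod_cast Nat.one_le_iff_ne_zero.mpr
      (by rw [Ne, Ideal.absNorm_eq_zero_iff]; exact Ideal.ne_bot_of_mem_primesOver v.ne_bot hw')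
  have hcond : P.logCond = (Module.finrank ℚ P.F : ℝ)⁻¹ *
      ∑ v ∈ S, Real.log (Ideal.absNorm v.asIdeal : ℝ) := P.logCond_eq_sum' hP
  have hdiff : P.logDiff = (Module.finrank ℚ P.F : ℝ)⁻¹ * Real.log ((discr P.F).natAbs : ℝ) :=
    P.logDiff_eq_log_discr
  rw [hcond, hdiff]
  have hKinv : 0 ≤ (Module.finrank ℚ P.F : ℝ)⁻¹ := inv_nonneg.mpr hKpos.le
  have hNinv : 0 ≤ (Module.finrank ℚ N : ℝ)⁻¹ := inv_nonneg.mpr hNpos.le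
  have h4 : (Module.finrank ℚ P.F : ℝ)⁻¹ * ∑ v ∈ S ∪ E, Real.log (Ideal.absNorm v.asIdeal : ℝ) ≤
      (Module.finrank ℚ P.F : ℝ)⁻¹ * ∑ v ∈ S, Real.log (Ideal.absNorm v.asIdeal : ℝ) + Real.log e := by
    calc _ ≤ (Module.finrank ℚ P.F : ℝ)⁻¹ * (∑ v ∈ S, Real.log (Ideal.absNorm v.asIdeal : ℝ) +
          Module.finrank ℚ P.F * Real.log e) := mul_le_mul_of_nonneg_left (h1.trans (by linarith)) hKinv
      _ = _ := by field_simp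
  have h5 : 0 ≤ (Module.finrank ℚ N : ℝ)⁻¹ * ∑ v ∈ S ∪ E,
      ∑ w ∈ IsDedekindDomain.primesOverFinset v.asIdeal (𝓞 N), Real.log (Ideal.absNorm w : ℝ) :=
    mul_nonneg hNinv h3
  linarith

end Kummer

end Literature.NumberTheory.DiophantineGeometry.GenEll

end
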